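import Mathlib
import HarnessLib
import Summits.HubbardSuperconductivity.HubbardSuperconductivity.Theorems.KLProgrammeC4aPartnerBandCooperDefect
import Summits.HubbardSuperconductivity.HubbardSuperconductivity.Theorems.KLProgrammeC4aPartnerBandCrossings
import Summits.HubbardSuperconductivity.HubbardSuperconductivity.Theorems.KLProgrammeC4aPathRigidity
import Summits.HubbardSuperconductivity.HubbardSuperconductivity.Theorems.KLProgrammeC4aLevelDensityRadialVertex
import Summits.HubbardSuperconductivity.HubbardSuperconductivity.Theorems.KLProgrammeC4aBoxIntegralContinuity

/-!
# Route `KLProgramme` — crux C4a, S3 brick (B4) «(U1)-HYBRID» part D-1: THE UMKLAPP NUMERATOR OF THE FIRST-ORDER LAYER AND ITS ROWS — the configuration-dependent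
# numerator `Y(ϑ,e,v) = c_d(ϑ,v)·c_C(ϑ)·J(e,v)·De_K(S(ϑ) − Φ(e,v+θ))[S′(ϑ)]` (cut-offs `c_d`, `c_C` vanishing near the direct caustic / on the Cooper class) satisfies the eight numerator rows of
# `umkLoopCircle_integral[_middle]_le_canonical` (U7), the two null rows BY CONSTRUCTION

Cell `gate-hubbard-kl`, seat hubbard-kl-k3c3-p3 (g36; row «implicit-function / monotonicity route for μ(n)»).  Located brick for the (C)-closer lane / the (M4)
assembly of the umklapp first-order ϑ-layer (stub (C) `stub_twoLeg_curvature` of `KLRegimeEngineV17F2`, stmt-HubbardSuperconductivity-20437), memo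
HOME/hubbard-kl-k3c3-p3/U1-CAUSTIC-SUP.md §19 «(U1)-NUMERATOR-ϑ» / «(U1)-HYBRID».

WHY.  The first-order co-moving jet of the tube bubble is `∫de w ∫dv J(e,v+θ)·G(ϑ,e,v)·(K e)′(ē)` with the GEOMETRIC FACTOR
`G(ϑ,e,v) := De_K(S(ϑ) − Φ(e,v+θ))[S′(ϑ)]`, `S(ϑ) = pairSumPath μ K ρ ϑ θ 0`, `S′(ϑ) = ∂_sΦ(0,θ) + ∂_sΦ(ρ,ϑ+θ)` ((B3); B4-UMK1-DESIGN §2).  The hybrid design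
(memo §19) hands the umklapp ladder the numerator `Y := c_d·c_C·J·G` with CUT-OFFS `c_d(ϑ,v)`, `c_C(ϑ)` carried abstractly (`C¹` in `v`, values in `[0,1]`,
`|∂_v c_d| ≤ B_d`, jointly continuous, `c_d = 0` when `‖S(ϑ) − 2Φ(0,v+θ)‖ ≤ τ₁`, `c_C = 0` when `‖S(ϑ)‖ ≤ s₁` — rows; e.g. `1 − χ(‖·‖²)` with `χ` a rescaled `Real.smoothTransition`) and an abstract smooth
factor `J(e,v)` (the rotated Jacobian × whatever the kernel side keeps outside `(K e)′`; rows: `C¹` in `v`, jointly continuous, `|J| ≤ J₀`, `|∂_vJ| ≤ J₁`, `e`-Lipschitz `J_L`,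
`2π`-periodic).  This file proves the rows U7 asks of `Y` at every `ϑ`:
* `hasDerivAt_geomFactor`, `abs_geomFactor_le` (`≤ K₁·2msD₁`), `abs_deriv_geomFactor_le` (`≤ K₂msD₁·2msD₁`), `abs_geomFactor_sub_le` (`e`-Lipschitz `K₂·2msD₁/(Dt−2A)`),
  `continuousOn_geomFactor₃` (joint continuity on `ℝ × [−hi,hi] × ℝ`);
* **`umkNumerator_null_dir`**, **`umkNumerator_null_cooper`** — the two null rows `hYnull`, `hCnull` of U7, by construction;
* **`umkNumerator_contDiff`**, **`umkNumerator_continuousOn₃`**, **`umkNumerator_abs_le`** (`Y₀ = J₀K₁·2msD₁`), **`umkNumerator_abs_deriv_le`**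
  (`Y₁ = B_d·J₀K₁·2msD₁ + J₁K₁·2msD₁ + J₀K₂msD₁·2msD₁`), **`umkNumerator_lipschitz`** (`Y_L = J_L·K₁·2msD₁ + J₀K₂·2msD₁/(Dt−2A)`),
  **`umkNumerator_periodic`** — the six analytic rows.
Sizes binder shape; pure calculus on landed objects; nothing about the model's kernel; nothing asserts (C), K3 or superconductivity.
References: FST II CPAM 51 (1998) §3 [cite: FeldmanSalmhoferTrubowitz1998]; BGM 2006 §2.4 [cite: BenfattoGiulianiMastropietro2006].
-/

noncomputable section

namespace Summit.HubbardSuperconductivity.HubbardSuperconductivity.Theorems.C4a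

set_option linter.dupNamespace false -- summit = problem name (single-conjunct summit), D-0017

open Real Set Filter
open scoped Topology RealInnerProductSpace
open Literature.MathematicalPhysics.QuantumLattice Literature.MathematicalPhysics.QuantumLattice.BandSectorCounting Literature.Probability.LatticeModels
open Summit.HubbardSuperconductivity.HubbardSuperconductivity.Theorems.KLRegimeSplit
open Summit.HubbardSuperconductivity.HubbardSuperconductivity.Theorems.DispersionFlow
open Summit.HubbardSuperconductivity.HubbardSuperconductivity.Theorems.PerturbedFermiCurve

section Sizes

variable {K : TrigPolyC4v} {A : ℝ} (hA : ∀ p : Momentum, ∀ j ≤ 2, ‖iteratedFDeriv ℝ j (frameShift K) p‖ ≤ A) (hA20 : A ≤ 1 / 20)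
  (hd : klCurveD ≤ (bandBounds (show (-4 : ℝ) < -1.1 by norm_num) (show (-1.1 : ℝ) ≤ -0.1 by norm_num)
    (show (-0.1 : ℝ) < 0 by norm_num)).Dtmin - 2 * A)
  {μ r : ℝ} (hr : 0 < r) (hlo : (-1.1 : ℝ) < μ - r - A) (hhi : μ + r + A < -0.1)
  {A₃ A₄ : ℝ} (hA₃ : ∀ p : Momentum, ‖iteratedFDeriv ℝ 3 (frameShift K) p‖ ≤ A₃)
  (hA₄ : ∀ p : Momentum, ‖iteratedFDeriv ℝ 4 (frameShift K) p‖ ≤ A₄)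
  {K₁ K₂ : ℝ} (hK₁ : ∀ p : Momentum, ‖fderiv ℝ (frameLevel μ K) p‖ ≤ K₁) (hK₂ : ∀ p : Momentum, ‖iteratedFDeriv ℝ 2 (frameLevel μ K) p‖ ≤ K₂)
include hA hA20 hd hr hlo hhi hA₃ hA₄ hK₁ hK₂

/-! ## §1 The geometric factor `G(ϑ,e,v) = De_K(S(ϑ) − Φ(e,v+θ))[S′(ϑ)]` -/

omit hr hK₁ hK₂ in
/-- **Size of `S′`**: `‖∂_sΦ(0,θ) + ∂_sΦ(ρ,ϑ+θ)‖ ≤ 2·msD₁` (`|ρ| < r`). -/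
theorem norm_pairSumVel_le {ρ : ℝ} (hρ : |ρ| < r) (ϑ θ : ℝ) :
    ‖iteratedDeriv 1 (levelPoint μ K 0) θ + iteratedDeriv 1 (levelPoint μ K ρ) (ϑ + θ)‖ ≤ 2 * msD A₃ A₄ 1 := by
  have h0 : |(0 : ℝ)| < r := by simpa using lt_of_le_of_lt (abs_nonneg ρ) hρ
  have h1 := norm_iteratedDeriv_levelPoint_le hA hA20 hd hlo hhi hA₃ hA₄ h0 le_rfl (by norm_num) θ
  have h2 := norm_iteratedDeriv_levelPoint_le hA hA20 hd hlo hhi hA₃ hA₄ hρ le_rfl (by norm_num) (ϑ + θ)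
  exact (norm_add_le _ _).trans (by linarith only [h1, h2])

omit hA20 hr hA₃ hA₄ hK₁ hK₂ in
/-- **The partner momentum is `C^∞` in the loop angle**: `v ↦ S − Φ(e,v+θ)` (`|e| < r`). -/
theorem contDiff_partner_pp_angle (S : Momentum) {e : ℝ} (he : |e| < r) (θ : ℝ) (n : ℕ) :
    ContDiff ℝ n (fun v : ℝ => S - levelPoint μ K e (v + θ)) := by
  have h := contDiff_levelPoint_of_sizes hA hd hlo hhi he n
  exact contDiff_const.sub (h.comp (contDiff_id.add contDiff_const))

omit hA20 hr hA₃ hA₄ hK₁ hK₂ in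
/-- **Derivative of the partner momentum in the loop angle**: `∂_v(S − Φ(e,v+θ)) = −∂_sΦ(e,v+θ)`. -/
theorem hasDerivAt_partner_pp_angle (S : Momentum) {e : ℝ} (he : |e| < r) (θ v : ℝ) :
    HasDerivAt (fun v : ℝ => S - levelPoint μ K e (v + θ)) (-iteratedDeriv 1 (levelPoint μ K e) (v + θ)) v := by
  have hdiff : Differentiable ℝ (levelPoint μ K e) := (contDiff_levelPoint_of_sizes hA hd hlo hhi he 1).differentiable (by norm_num)
  have h1 : HasDerivAt (fun v : ℝ => levelPoint μ K e (v + θ)) (deriv (levelPoint μ K e) (v + θ)) v := by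
    have := (hdiff (v + θ)).hasDerivAt
    exact this.comp_add_const v θ |>.congr_deriv (by simp)
  rw [iteratedDeriv_one]
  exact (hasDerivAt_const v S).sub h1 |>.congr_deriv (by simp)

omit hA20 hr hA₃ hA₄ hK₁ hK₂ in
/-- **The geometric factor is differentiable in the loop angle**, with derivative `D²e_K(P)[−∂_sΦ(e,v+θ)] S′`. -/
theorem hasDerivAt_geomFactor (S Sp : Momentum) {e : ℝ} (he : |e| < r) (θ v : ℝ) :
    HasDerivAt (fun v : ℝ => (fderiv ℝ (frameLevel μ K) (S - levelPoint μ K e (v + θ))) Sp)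
      ((fderiv ℝ (fderiv ℝ (frameLevel μ K)) (S - levelPoint μ K e (v + θ)) (-iteratedDeriv 1 (levelPoint μ K e) (v + θ))) Sp) v := by
  have hfe := EngineV8.contDiff_frameLevel μ K (n := 2)
  have hD : Differentiable ℝ (fderiv ℝ (frameLevel μ K)) := (hfe.fderiv_right (m := 1) (by norm_num)).differentiable one_ne_zero
  have hP := hasDerivAt_partner_pp_angle hA hd hlo hhi S he θ v
  have hcomp : HasDerivAt (fun v : ℝ => fderiv ℝ (frameLevel μ K) (S - levelPoint μ K e (v + θ)))
      ((fderiv ℝ (fderiv ℝ (frameLevel μ K)) (S - levelPoint μ K e (v + θ))) (-iteratedDeriv 1 (levelPoint μ K e) (v + θ))) v :=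
    (hD _).hasFDerivAt.comp_hasDerivAt v hP
  exact hcomp.clm_apply (hasDerivAt_const v Sp) |>.congr_deriv (by simp)

omit hA hA20 hd hr hlo hhi hA₃ hA₄ hK₂ in
/-- **Size of the geometric factor**: `|De_K(P)[S′]| ≤ K₁‖S′‖`. -/
theorem abs_geomFactor_le_mul (P Sp : Momentum) : |(fderiv ℝ (frameLevel μ K) P) Sp| ≤ K₁ * ‖Sp‖ := by
  rw [← Real.norm_eq_abs]
  exact (ContinuousLinearMap.le_opNorm _ _).trans (mul_le_mul_of_nonneg_right (hK₁ P) (norm_nonneg _))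

omit hA hA20 hd hr hlo hhi hA₃ hA₄ hK₁ in
/-- **Size of the second differential**: `‖D²e_K(P)[u] w‖ ≤ K₂‖u‖‖w‖`. -/
theorem abs_fderiv_fderiv_frameLevel_le (P u w : Momentum) : |(fderiv ℝ (fderiv ℝ (frameLevel μ K)) P u) w| ≤ K₂ * ‖u‖ * ‖w‖ := by
  rw [← Real.norm_eq_abs]
  have h1 : ‖fderiv ℝ (fderiv ℝ (frameLevel μ K)) P u‖ ≤ K₂ * ‖u‖ := by
    refine (ContinuousLinearMap.le_opNorm _ _).trans (mul_le_mul_of_nonneg_right ?_ (norm_nonneg _))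
    rw [norm_fderiv_two_eq_norm_iteratedFDeriv]; exact hK₂ P
  exact (ContinuousLinearMap.le_opNorm _ _).trans (mul_le_mul_of_nonneg_right h1 (norm_nonneg _))

omit hA hA20 hd hr hlo hhi hA₃ hA₄ hK₁ in
/-- **The geometric factor is `K₂‖S′‖`-Lipschitz in the partner momentum**: `|De_K(P)[S′] − De_K(Q)[S′]| ≤ K₂‖P − Q‖‖S′‖`. -/
theorem abs_geomFactor_sub_le_mul (P Q Sp : Momentum) :
    |(fderiv ℝ (frameLevel μ K) P) Sp - (fderiv ℝ (frameLevel μ K) Q) Sp| ≤ K₂ * ‖P - Q‖ * ‖Sp‖ := by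
  have h : (fderiv ℝ (frameLevel μ K) P) Sp - (fderiv ℝ (frameLevel μ K) Q) Sp = (fderiv ℝ (frameLevel μ K) P - fderiv ℝ (frameLevel μ K) Q) Sp := rfl
  rw [h, ← Real.norm_eq_abs]
  exact (ContinuousLinearMap.le_opNorm _ _).trans
    (mul_le_mul_of_nonneg_right (norm_fderiv_frameLevel_sub_le hK₂ P Q) (norm_nonneg _))

/-! ## §2 The umklapp numerator `Y(ϑ,e,v) = c_d(ϑ,v)·c_C(ϑ)·J(e,v)·G(ϑ,e,v)` and its rows

The cut-offs are carried ABSTRACTLY: `cd : ℝ → ℝ → ℝ` (`C¹` in `v`, values in `[0,1]`, `|∂_v c_d| ≤ B_d`, jointly continuous, VANISHING when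
`‖S(ϑ) − 2Φ(0,v+θ)‖ ≤ τ₁`) and `cc : ℝ → ℝ` (values in `[0,1]`, continuous, vanishing when `‖S(ϑ)‖ ≤ s₁`) — e.g. `1 − χ(‖·‖²)` with `χ` a rescaled
`Real.smoothTransition`; the consumer's choice. -/

omit hA hA20 hd hr hlo hhi hA₃ hA₄ hK₁ hK₂ in
/-- **NULL ROW AT THE DIRECT CAUSTIC** (`hYnull` of U7): the numerator vanishes whenever `‖S(ϑ) − 2Φ(0,v+θ)‖ ≤ τ₁`. -/
theorem umkNumerator_null_dir (ρ θ : ℝ) {cd : ℝ → ℝ → ℝ} {cc : ℝ → ℝ} {Jw : ℝ → ℝ → ℝ} {τ₁ : ℝ}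
    (hcdnull : ∀ ϑ v, ‖pairSumPath μ K ρ ϑ θ 0 - (2 : ℝ) • levelPoint μ K 0 (v + θ)‖ ≤ τ₁ → cd ϑ v = 0)
    (ϑ e v : ℝ) (h : ‖pairSumPath μ K ρ ϑ θ 0 - (2 : ℝ) • levelPoint μ K 0 (v + θ)‖ ≤ τ₁) :
    cd ϑ v * cc ϑ * Jw e v * (fderiv ℝ (frameLevel μ K) (pairSumPath μ K ρ ϑ θ 0 - levelPoint μ K e (v + θ))) (iteratedDeriv 1 (levelPoint μ K 0) θ + iteratedDeriv 1 (levelPoint μ K ρ) (ϑ + θ)) = 0 := by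
  rw [hcdnull ϑ v h]; ring

omit hA hA20 hd hr hlo hhi hA₃ hA₄ hK₁ hK₂ in
/-- **NULL ROW ON THE COOPER CLASS** (`hCnull` of U7): the numerator vanishes whenever `‖S(ϑ)‖ ≤ s₁`. -/
theorem umkNumerator_null_cooper (ρ θ : ℝ) {cd : ℝ → ℝ → ℝ} {cc : ℝ → ℝ} {Jw : ℝ → ℝ → ℝ} {s₁ : ℝ}
    (hccnull : ∀ ϑ, ‖pairSumPath μ K ρ ϑ θ 0‖ ≤ s₁ → cc ϑ = 0) (ϑ e v : ℝ) (h : ‖pairSumPath μ K ρ ϑ θ 0‖ ≤ s₁) :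
    cd ϑ v * cc ϑ * Jw e v * (fderiv ℝ (frameLevel μ K) (pairSumPath μ K ρ ϑ θ 0 - levelPoint μ K e (v + θ))) (iteratedDeriv 1 (levelPoint μ K 0) θ + iteratedDeriv 1 (levelPoint μ K ρ) (ϑ + θ)) = 0 := by
  rw [hccnull ϑ h]; ring

omit hr hK₂ in
/-- **SUP ROW** (`hYb` of U7): `|Y| ≤ J₀·K₁·2msD₁` (cut-offs in `[0,1]`, `|J| ≤ J₀`). -/
theorem umkNumerator_abs_le {ρ : ℝ} (hρ : |ρ| < r) (θ : ℝ) {cd : ℝ → ℝ → ℝ} {cc : ℝ → ℝ} {Jw : ℝ → ℝ → ℝ} {hi J₀ : ℝ}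
    (hcd0 : ∀ ϑ v, 0 ≤ cd ϑ v) (hcd1 : ∀ ϑ v, cd ϑ v ≤ 1) (hcc0 : ∀ ϑ, 0 ≤ cc ϑ) (hcc1 : ∀ ϑ, cc ϑ ≤ 1)
    (hJb : ∀ e ∈ Icc (-hi) hi, ∀ v, |Jw e v| ≤ J₀) (ϑ : ℝ) {e : ℝ} (he : e ∈ Icc (-hi) hi) (v : ℝ) :
    |cd ϑ v * cc ϑ * Jw e v * (fderiv ℝ (frameLevel μ K) (pairSumPath μ K ρ ϑ θ 0 - levelPoint μ K e (v + θ))) (iteratedDeriv 1 (levelPoint μ K 0) θ + iteratedDeriv 1 (levelPoint μ K ρ) (ϑ + θ))| ≤ J₀ * (K₁ * (2 * msD A₃ A₄ 1)) := by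
  have hJ0 : 0 ≤ J₀ := (abs_nonneg _).trans (hJb e he v)
  have h1 : |cd ϑ v| ≤ 1 := by rw [abs_le]; constructor <;> linarith [hcd0 ϑ v, hcd1 ϑ v]
  have h2 : |cc ϑ| ≤ 1 := by rw [abs_le]; constructor <;> linarith [hcc0 ϑ, hcc1 ϑ]
  have h3 := hJb e he v
  have h4 : |(fderiv ℝ (frameLevel μ K) (pairSumPath μ K ρ ϑ θ 0 - levelPoint μ K e (v + θ))) (iteratedDeriv 1 (levelPoint μ K 0) θ + iteratedDeriv 1 (levelPoint μ K ρ) (ϑ + θ))| ≤ K₁ * (2 * msD A₃ A₄ 1) :=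
    (abs_geomFactor_le_mul hK₁ _ _).trans (mul_le_mul_of_nonneg_left (norm_pairSumVel_le hA hA20 hd hlo hhi hA₃ hA₄ hρ ϑ θ)
      ((norm_nonneg _).trans (hK₁ 0)))
  have hG0 : 0 ≤ K₁ * (2 * msD A₃ A₄ 1) := (abs_nonneg _).trans h4
  rw [abs_mul, abs_mul, abs_mul]
  calc |cd ϑ v| * |cc ϑ| * |Jw e v| * |(fderiv ℝ (frameLevel μ K) (pairSumPath μ K ρ ϑ θ 0 - levelPoint μ K e (v + θ))) (iteratedDeriv 1 (levelPoint μ K 0) θ + iteratedDeriv 1 (levelPoint μ K ρ) (ϑ + θ))|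
      ≤ 1 * 1 * J₀ * (K₁ * (2 * msD A₃ A₄ 1)) := by gcongr
    _ = J₀ * (K₁ * (2 * msD A₃ A₄ 1)) := by ring

omit hA hA20 hd hr hlo hhi hA₃ hA₄ hK₁ hK₂ in
/-- **PERIODICITY ROW** (`hYper` of U7): `Y(ϑ,e,v+2π) = Y(ϑ,e,v)` (`Φ` is `2π`-periodic in the angle; `c_d`, `J` periodic by hypothesis). -/
theorem umkNumerator_periodic (ρ θ : ℝ) {cd : ℝ → ℝ → ℝ} {cc : ℝ → ℝ} {Jw : ℝ → ℝ → ℝ} {hi : ℝ}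
    (hcdper : ∀ ϑ v, cd ϑ (v + 2 * π) = cd ϑ v) (hJper : ∀ e ∈ Icc (-hi) hi, ∀ v, Jw e (v + 2 * π) = Jw e v)
    (ϑ : ℝ) {e : ℝ} (he : e ∈ Icc (-hi) hi) (v : ℝ) :
    cd ϑ (v + 2 * π) * cc ϑ * Jw e (v + 2 * π) * (fderiv ℝ (frameLevel μ K) (pairSumPath μ K ρ ϑ θ 0 - levelPoint μ K e ((v + 2 * π) + θ))) (iteratedDeriv 1 (levelPoint μ K 0) θ + iteratedDeriv 1 (levelPoint μ K ρ) (ϑ + θ)) =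
    cd ϑ v * cc ϑ * Jw e v * (fderiv ℝ (frameLevel μ K) (pairSumPath μ K ρ ϑ θ 0 - levelPoint μ K e (v + θ))) (iteratedDeriv 1 (levelPoint μ K 0) θ + iteratedDeriv 1 (levelPoint μ K ρ) (ϑ + θ)) := by
  rw [show v + 2 * π + θ = v + θ + 2 * π by ring, levelPoint_add_two_pi, hcdper ϑ v, hJper e he v]

set_option maxHeartbeats 400000 in
omit hA20 hr hA₃ hA₄ hK₁ hK₂ in
/-- **`C¹` ROW** (`hYd` of U7): `v ↦ Y(ϑ,e,v)` is `C¹` (`|e| ≤ hi < r`; `c_d(ϑ,·)`, `J(e,·)` of class `C¹`). -/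
theorem umkNumerator_contDiff (ρ θ : ℝ) {cd : ℝ → ℝ → ℝ} {cc : ℝ → ℝ} {Jw : ℝ → ℝ → ℝ} {hi : ℝ} (hhir : hi < r)
    (hcd : ∀ ϑ, ContDiff ℝ 1 (cd ϑ)) (hJd : ∀ e ∈ Icc (-hi) hi, ContDiff ℝ 1 (Jw e)) (ϑ : ℝ) {e : ℝ} (he : e ∈ Icc (-hi) hi) :
    ContDiff ℝ 1 (fun v : ℝ => cd ϑ v * cc ϑ * Jw e v * (fderiv ℝ (frameLevel μ K) (pairSumPath μ K ρ ϑ θ 0 - levelPoint μ K e (v + θ))) (iteratedDeriv 1 (levelPoint μ K 0) θ + iteratedDeriv 1 (levelPoint μ K ρ) (ϑ + θ))) := by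
  have her : |e| < r := abs_lt.2 ⟨by linarith only [he.1, hhir], lt_of_le_of_lt he.2 hhir⟩
  have hP : ContDiff ℝ 1 (fun v : ℝ => (pairSumPath μ K ρ ϑ θ 0 - levelPoint μ K e (v + θ))) := contDiff_partner_pp_angle hA hd hlo hhi _ her θ 1
  have hfe := EngineV8.contDiff_frameLevel μ K (n := 2)
  have hG1 : ContDiff ℝ 1 (fun v : ℝ => fderiv ℝ (frameLevel μ K) (pairSumPath μ K ρ ϑ θ 0 - levelPoint μ K e (v + θ))) :=
    (hfe.fderiv_right (m := 1) (by norm_num)).comp hP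
  have hG : ContDiff ℝ 1 (fun v : ℝ => (fderiv ℝ (frameLevel μ K) (pairSumPath μ K ρ ϑ θ 0 - levelPoint μ K e (v + θ))) (iteratedDeriv 1 (levelPoint μ K 0) θ + iteratedDeriv 1 (levelPoint μ K ρ) (ϑ + θ))) :=
    hG1.clm_apply contDiff_const
  have hk : ContDiff ℝ 1 (fun _ : ℝ => cc ϑ) := contDiff_const
  have h1 : ContDiff ℝ 1 (fun v : ℝ => cd ϑ v * cc ϑ) := (hcd ϑ).mul hk
  have h2 : ContDiff ℝ 1 (fun v : ℝ => cd ϑ v * cc ϑ * Jw e v) := h1.mul (hJd e he)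
  exact h2.mul hG

set_option maxHeartbeats 400000 in
omit hr in
/-- **DERIVATIVE ROW** (`hY1` of U7): `|∂_v Y| ≤ B_d·J₀·K₁·2msD₁ + J₁·K₁·2msD₁ + J₀·K₂msD₁·2msD₁` (product rule; `|∂_v c_d| ≤ B_d`, `|∂_vJ| ≤ J₁`,
`|∂_v G| ≤ K₂‖∂_sΦ(e,·)‖‖S′‖`). -/
theorem umkNumerator_abs_deriv_le {ρ : ℝ} (hρ : |ρ| < r) (θ : ℝ) {cd : ℝ → ℝ → ℝ} {cc : ℝ → ℝ} {Jw : ℝ → ℝ → ℝ} {hi J₀ J₁ Bd : ℝ}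
    (hhir : hi < r) (hcd : ∀ ϑ, ContDiff ℝ 1 (cd ϑ)) (hcd0 : ∀ ϑ v, 0 ≤ cd ϑ v) (hcd1 : ∀ ϑ v, cd ϑ v ≤ 1) (hcdd : ∀ ϑ v, |deriv (cd ϑ) v| ≤ Bd)
    (hcc0 : ∀ ϑ, 0 ≤ cc ϑ) (hcc1 : ∀ ϑ, cc ϑ ≤ 1)
    (hJd : ∀ e ∈ Icc (-hi) hi, ContDiff ℝ 1 (Jw e)) (hJb : ∀ e ∈ Icc (-hi) hi, ∀ v, |Jw e v| ≤ J₀) (hJ1 : ∀ e ∈ Icc (-hi) hi, ∀ v, |deriv (Jw e) v| ≤ J₁)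
    (ϑ : ℝ) {e : ℝ} (he : e ∈ Icc (-hi) hi) (v : ℝ) :
    |deriv (fun v : ℝ => cd ϑ v * cc ϑ * Jw e v * (fderiv ℝ (frameLevel μ K) (pairSumPath μ K ρ ϑ θ 0 - levelPoint μ K e (v + θ))) (iteratedDeriv 1 (levelPoint μ K 0) θ + iteratedDeriv 1 (levelPoint μ K ρ) (ϑ + θ))) v| ≤
      Bd * J₀ * (K₁ * (2 * msD A₃ A₄ 1)) + J₁ * (K₁ * (2 * msD A₃ A₄ 1)) + J₀ * (K₂ * msD A₃ A₄ 1 * (2 * msD A₃ A₄ 1)) := by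
  have her : |e| < r := abs_lt.2 ⟨by linarith only [he.1, hhir], lt_of_le_of_lt he.2 hhir⟩
  have hJ0 : 0 ≤ J₀ := (abs_nonneg _).trans (hJb e he v)
  have hK₁0 : 0 ≤ K₁ := (norm_nonneg _).trans (hK₁ 0)
  have hK₂0 : 0 ≤ K₂ := (norm_nonneg _).trans (hK₂ 0)
  have hD1 : 0 ≤ msD A₃ A₄ 1 := (norm_nonneg _).trans (norm_iteratedDeriv_levelPoint_le hA hA20 hd hlo hhi hA₃ hA₄ her le_rfl (by norm_num) 0)
  -- the four factors and their derivatives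
  have ha : HasDerivAt (cd ϑ) (deriv (cd ϑ) v) v := (((hcd ϑ).differentiable (by norm_num)) v).hasDerivAt
  have hJ : HasDerivAt (Jw e) (deriv (Jw e) v) v := (((hJd e he).differentiable (by norm_num)) v).hasDerivAt
  have hG := hasDerivAt_geomFactor hA hd hlo hhi (pairSumPath μ K ρ ϑ θ 0) (iteratedDeriv 1 (levelPoint μ K 0) θ + iteratedDeriv 1 (levelPoint μ K ρ) (ϑ + θ)) her θ v
  have hprod : HasDerivAt (fun v : ℝ => cd ϑ v * cc ϑ * Jw e v * (fderiv ℝ (frameLevel μ K) (pairSumPath μ K ρ ϑ θ 0 - levelPoint μ K e (v + θ))) (iteratedDeriv 1 (levelPoint μ K 0) θ + iteratedDeriv 1 (levelPoint μ K ρ) (ϑ + θ)))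
      ((deriv (cd ϑ) v * cc ϑ * Jw e v + cd ϑ v * cc ϑ * deriv (Jw e) v) * (fderiv ℝ (frameLevel μ K) (pairSumPath μ K ρ ϑ θ 0 - levelPoint μ K e (v + θ))) (iteratedDeriv 1 (levelPoint μ K 0) θ + iteratedDeriv 1 (levelPoint μ K ρ) (ϑ + θ)) +
        cd ϑ v * cc ϑ * Jw e v * (fderiv ℝ (fderiv ℝ (frameLevel μ K)) (pairSumPath μ K ρ ϑ θ 0 - levelPoint μ K e (v + θ)) (-iteratedDeriv 1 (levelPoint μ K e) (v + θ))) (iteratedDeriv 1 (levelPoint μ K 0) θ + iteratedDeriv 1 (levelPoint μ K ρ) (ϑ + θ))) v :=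
    ((ha.mul_const (cc ϑ)).mul hJ).mul hG
  rw [hprod.deriv]
  -- sizes
  have hSp := norm_pairSumVel_le hA hA20 hd hlo hhi hA₃ hA₄ hρ ϑ θ
  have hG0 : |(fderiv ℝ (frameLevel μ K) (pairSumPath μ K ρ ϑ θ 0 - levelPoint μ K e (v + θ))) (iteratedDeriv 1 (levelPoint μ K 0) θ + iteratedDeriv 1 (levelPoint μ K ρ) (ϑ + θ))| ≤ K₁ * (2 * msD A₃ A₄ 1) :=
    (abs_geomFactor_le_mul hK₁ _ _).trans (mul_le_mul_of_nonneg_left hSp hK₁0)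
  have hΦs : ‖-iteratedDeriv 1 (levelPoint μ K e) (v + θ)‖ ≤ msD A₃ A₄ 1 := by
    rw [norm_neg]; exact norm_iteratedDeriv_levelPoint_le hA hA20 hd hlo hhi hA₃ hA₄ her le_rfl (by norm_num) (v + θ)
  have hG1 : |(fderiv ℝ (fderiv ℝ (frameLevel μ K)) (pairSumPath μ K ρ ϑ θ 0 - levelPoint μ K e (v + θ)) (-iteratedDeriv 1 (levelPoint μ K e) (v + θ))) (iteratedDeriv 1 (levelPoint μ K 0) θ + iteratedDeriv 1 (levelPoint μ K ρ) (ϑ + θ))| ≤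
      K₂ * msD A₃ A₄ 1 * (2 * msD A₃ A₄ 1) := by
    refine (abs_fderiv_fderiv_frameLevel_le hK₂ _ _ _).trans ?_
    have := mul_le_mul hΦs hSp (norm_nonneg _) hD1
    calc K₂ * ‖-iteratedDeriv 1 (levelPoint μ K e) (v + θ)‖ * ‖(iteratedDeriv 1 (levelPoint μ K 0) θ + iteratedDeriv 1 (levelPoint μ K ρ) (ϑ + θ))‖
        = K₂ * (‖-iteratedDeriv 1 (levelPoint μ K e) (v + θ)‖ * ‖(iteratedDeriv 1 (levelPoint μ K 0) θ + iteratedDeriv 1 (levelPoint μ K ρ) (ϑ + θ))‖) := by ring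
      _ ≤ K₂ * (msD A₃ A₄ 1 * (2 * msD A₃ A₄ 1)) := mul_le_mul_of_nonneg_left this hK₂0
      _ = K₂ * msD A₃ A₄ 1 * (2 * msD A₃ A₄ 1) := by ring
  have h1 : |cd ϑ v| ≤ 1 := by rw [abs_le]; constructor <;> linarith [hcd0 ϑ v, hcd1 ϑ v]
  have h2 : |cc ϑ| ≤ 1 := by rw [abs_le]; constructor <;> linarith [hcc0 ϑ, hcc1 ϑ]
  have h3 := hJb e he v
  have h4 := hJ1 e he v
  have h5 := hcdd ϑ v
  have hBd0 : 0 ≤ Bd := (abs_nonneg _).trans h5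
  have hJ10 : 0 ≤ J₁ := (abs_nonneg _).trans h4
  -- assemble
  set a := cd ϑ v; set a' := deriv (cd ϑ) v; set c := cc ϑ; set J := Jw e v; set J' := deriv (Jw e) v
  set G := (fderiv ℝ (frameLevel μ K) (pairSumPath μ K ρ ϑ θ 0 - levelPoint μ K e (v + θ))) (iteratedDeriv 1 (levelPoint μ K 0) θ + iteratedDeriv 1 (levelPoint μ K ρ) (ϑ + θ))
  set G' := (fderiv ℝ (fderiv ℝ (frameLevel μ K)) (pairSumPath μ K ρ ϑ θ 0 - levelPoint μ K e (v + θ)) (-iteratedDeriv 1 (levelPoint μ K e) (v + θ))) (iteratedDeriv 1 (levelPoint μ K 0) θ + iteratedDeriv 1 (levelPoint μ K ρ) (ϑ + θ))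
  calc |((a' * c * J + a * c * J') * G + a * c * J * G')|
      ≤ |(a' * c * J + a * c * J') * G| + |a * c * J * G'| := abs_add_le _ _
    _ ≤ (|a' * c * J| + |a * c * J'|) * |G| + |a * c * J * G'| := by
        rw [abs_mul ((a' * c * J + a * c * J'))]; gcongr; exact abs_add_le _ _
    _ = (|a'| * |c| * |J| + |a| * |c| * |J'|) * |G| + |a| * |c| * |J| * |G'| := by simp only [abs_mul]
    _ ≤ (Bd * 1 * J₀ + 1 * 1 * J₁) * (K₁ * (2 * msD A₃ A₄ 1)) + 1 * 1 * J₀ * (K₂ * msD A₃ A₄ 1 * (2 * msD A₃ A₄ 1)) := by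
        gcongr
    _ = Bd * J₀ * (K₁ * (2 * msD A₃ A₄ 1)) + J₁ * (K₁ * (2 * msD A₃ A₄ 1)) + J₀ * (K₂ * msD A₃ A₄ 1 * (2 * msD A₃ A₄ 1)) := by ring

/-- **LEVEL-LIPSCHITZ ROW** (`hYLip` of U7): `|Y(ϑ,e,v) − Y(ϑ,lo,v)| ≤ (J_L·K₁·2msD₁ + J₀·K₂·2msD₁/(Dt−2A))·|e − lo|` for `e ∈ [lo, hi]`, `0 < lo`, `hi < r`
(`J` `e`-Lipschitz; `G` Lipschitz in the partner momentum; `‖Φ(e,·) − Φ(lo,·)‖ ≤ |e − lo|/(Dt−2A)`). -/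
theorem umkNumerator_lipschitz {ρ : ℝ} (hρ : |ρ| < r) (θ : ℝ) {cd : ℝ → ℝ → ℝ} {cc : ℝ → ℝ} {Jw : ℝ → ℝ → ℝ} {lo hi J₀ JL : ℝ}
    (hlo0 : 0 < lo) (hlohi : lo ≤ hi) (hhir : hi < r) (hcd0 : ∀ ϑ v, 0 ≤ cd ϑ v) (hcd1 : ∀ ϑ v, cd ϑ v ≤ 1) (hcc0 : ∀ ϑ, 0 ≤ cc ϑ) (hcc1 : ∀ ϑ, cc ϑ ≤ 1)
    (hJb : ∀ e ∈ Icc (-hi) hi, ∀ v, |Jw e v| ≤ J₀) (hJLip : ∀ e ∈ Icc lo hi, ∀ v, |Jw e v - Jw lo v| ≤ JL * |e - lo|)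
    (ϑ : ℝ) {e : ℝ} (he : e ∈ Icc lo hi) (v : ℝ) :
    |cd ϑ v * cc ϑ * Jw e v * (fderiv ℝ (frameLevel μ K) (pairSumPath μ K ρ ϑ θ 0 - levelPoint μ K e (v + θ))) (iteratedDeriv 1 (levelPoint μ K 0) θ + iteratedDeriv 1 (levelPoint μ K ρ) (ϑ + θ)) - cd ϑ v * cc ϑ * Jw lo v * (fderiv ℝ (frameLevel μ K) (pairSumPath μ K ρ ϑ θ 0 - levelPoint μ K lo (v + θ))) (iteratedDeriv 1 (levelPoint μ K 0) θ + iteratedDeriv 1 (levelPoint μ K ρ) (ϑ + θ))| ≤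
      (JL * (K₁ * (2 * msD A₃ A₄ 1)) + J₀ * (K₂ * (2 * msD A₃ A₄ 1) / ((bandBounds (show (-4 : ℝ) < -1.1 by norm_num) (show (-1.1 : ℝ) ≤ -0.1 by norm_num) (show (-0.1 : ℝ) < 0 by norm_num)).Dtmin - 2 * A))) * |e - lo| := by
  set B := (bandBounds (show (-4 : ℝ) < -1.1 by norm_num) (show (-1.1 : ℝ) ≤ -0.1 by norm_num) (show (-0.1 : ℝ) < 0 by norm_num)) with hBdef
  have hADt : 2 * A < B.Dtmin := by have := klCurveD_pos; linarith only [this, hd]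
  have hDt : 0 < B.Dtmin - 2 * A := by linarith only [hADt]
  have heI : e ∈ Ioo (-r) r := ⟨by linarith only [he.1, hlo0, hr], lt_of_le_of_lt he.2 hhir⟩
  have hloI : lo ∈ Ioo (-r) r := ⟨by linarith only [hlo0, hr], lt_of_le_of_lt hlohi hhir⟩
  have heh : e ∈ Icc (-hi) hi := ⟨by linarith only [he.1, hlo0, hlohi], he.2⟩
  have hloh : lo ∈ Icc (-hi) hi := ⟨by linarith only [hlo0, hlohi], hlohi⟩
  have hK₁0 : 0 ≤ K₁ := (norm_nonneg _).trans (hK₁ 0)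
  have hK₂0 : 0 ≤ K₂ := (norm_nonneg _).trans (hK₂ 0)
  have hJ0 : 0 ≤ J₀ := (abs_nonneg _).trans (hJb e heh v)
  have hSp := norm_pairSumVel_le hA hA20 hd hlo hhi hA₃ hA₄ hρ ϑ θ
  have hGe : |(fderiv ℝ (frameLevel μ K) (pairSumPath μ K ρ ϑ θ 0 - levelPoint μ K e (v + θ))) (iteratedDeriv 1 (levelPoint μ K 0) θ + iteratedDeriv 1 (levelPoint μ K ρ) (ϑ + θ))| ≤ K₁ * (2 * msD A₃ A₄ 1) :=
    (abs_geomFactor_le_mul hK₁ _ _).trans (mul_le_mul_of_nonneg_left hSp hK₁0)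
  -- the geometric factor is Lipschitz in the level
  have hPP : ‖(pairSumPath μ K ρ ϑ θ 0 - levelPoint μ K e (v + θ)) - (pairSumPath μ K ρ ϑ θ 0 - levelPoint μ K lo (v + θ))‖ ≤ |e - lo| / (B.Dtmin - 2 * A) := by
    have h := norm_levelPoint_sub_levelPoint_le B hA hADt hlo hhi heI hloI (v + θ)
    rw [show (pairSumPath μ K ρ ϑ θ 0 - levelPoint μ K e (v + θ)) - (pairSumPath μ K ρ ϑ θ 0 - levelPoint μ K lo (v + θ)) = -(levelPoint μ K e (v + θ) - levelPoint μ K lo (v + θ)) by abel, norm_neg]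
    exact h
  have hGG : |(fderiv ℝ (frameLevel μ K) (pairSumPath μ K ρ ϑ θ 0 - levelPoint μ K e (v + θ))) (iteratedDeriv 1 (levelPoint μ K 0) θ + iteratedDeriv 1 (levelPoint μ K ρ) (ϑ + θ)) - (fderiv ℝ (frameLevel μ K) (pairSumPath μ K ρ ϑ θ 0 - levelPoint μ K lo (v + θ))) (iteratedDeriv 1 (levelPoint μ K 0) θ + iteratedDeriv 1 (levelPoint μ K ρ) (ϑ + θ))| ≤
      K₂ * (2 * msD A₃ A₄ 1) / (B.Dtmin - 2 * A) * |e - lo| := by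
    refine (abs_geomFactor_sub_le_mul hK₂ _ _ _).trans ?_
    have := mul_le_mul hPP hSp (norm_nonneg _) (by positivity)
    calc K₂ * ‖(pairSumPath μ K ρ ϑ θ 0 - levelPoint μ K e (v + θ)) - (pairSumPath μ K ρ ϑ θ 0 - levelPoint μ K lo (v + θ))‖ * ‖(iteratedDeriv 1 (levelPoint μ K 0) θ + iteratedDeriv 1 (levelPoint μ K ρ) (ϑ + θ))‖ = K₂ * (‖(pairSumPath μ K ρ ϑ θ 0 - levelPoint μ K e (v + θ)) - (pairSumPath μ K ρ ϑ θ 0 - levelPoint μ K lo (v + θ))‖ * ‖(iteratedDeriv 1 (levelPoint μ K 0) θ + iteratedDeriv 1 (levelPoint μ K ρ) (ϑ + θ))‖) := by ring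
      _ ≤ K₂ * (|e - lo| / (B.Dtmin - 2 * A) * (2 * msD A₃ A₄ 1)) := mul_le_mul_of_nonneg_left this hK₂0
      _ = K₂ * (2 * msD A₃ A₄ 1) / (B.Dtmin - 2 * A) * |e - lo| := by field_simp
  have h1 : |cd ϑ v| ≤ 1 := by rw [abs_le]; constructor <;> linarith [hcd0 ϑ v, hcd1 ϑ v]
  have h2 : |cc ϑ| ≤ 1 := by rw [abs_le]; constructor <;> linarith [hcc0 ϑ, hcc1 ϑ]
  have h3 := hJLip e he v
  have h4 := hJb lo hloh v
  have hJL0 : 0 ≤ JL * |e - lo| := (abs_nonneg _).trans h3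
  set a := cd ϑ v; set c := cc ϑ; set J := Jw e v; set J₀' := Jw lo v
  set G := (fderiv ℝ (frameLevel μ K) (pairSumPath μ K ρ ϑ θ 0 - levelPoint μ K e (v + θ))) (iteratedDeriv 1 (levelPoint μ K 0) θ + iteratedDeriv 1 (levelPoint μ K ρ) (ϑ + θ))
  set G₀' := (fderiv ℝ (frameLevel μ K) (pairSumPath μ K ρ ϑ θ 0 - levelPoint μ K lo (v + θ))) (iteratedDeriv 1 (levelPoint μ K 0) θ + iteratedDeriv 1 (levelPoint μ K ρ) (ϑ + θ))
  have hid : a * c * J * G - a * c * J₀' * G₀' = a * c * ((J - J₀') * G + J₀' * (G - G₀')) := by ring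
  rw [hid, abs_mul, abs_mul]
  calc |a| * |c| * |(J - J₀') * G + J₀' * (G - G₀')|
      ≤ 1 * 1 * (|(J - J₀') * G| + |J₀' * (G - G₀')|) := by gcongr; exact abs_add_le _ _
    _ = |J - J₀'| * |G| + |J₀'| * |G - G₀'| := by rw [one_mul, one_mul, abs_mul, abs_mul]
    _ ≤ JL * |e - lo| * (K₁ * (2 * msD A₃ A₄ 1)) + J₀ * (K₂ * (2 * msD A₃ A₄ 1) / (B.Dtmin - 2 * A) * |e - lo|) := by
        gcongr
    _ = (JL * (K₁ * (2 * msD A₃ A₄ 1)) + J₀ * (K₂ * (2 * msD A₃ A₄ 1) / (B.Dtmin - 2 * A))) * |e - lo| := by ring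

set_option maxHeartbeats 400000 in
omit hA20 hr hA₃ hA₄ hK₁ hK₂ in
/-- **JOINT-CONTINUITY ROW** (`hY3` of U7): `(ϑ,e,v) ↦ Y(ϑ,e,v)` is continuous on `ℝ × [−hi,hi] × ℝ` (`hi < r`; `c_d` jointly continuous, `c_C` continuous,
`J` jointly continuous on `[−hi,hi] × ℝ`). -/
theorem umkNumerator_continuousOn₃ {ρ : ℝ} (hρ : |ρ| < r) (θ : ℝ) {cd : ℝ → ℝ → ℝ} {cc : ℝ → ℝ} {Jw : ℝ → ℝ → ℝ} {hi : ℝ} (hhir : hi < r)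
    (hcd2 : Continuous fun q : ℝ × ℝ => cd q.1 q.2) (hcc : Continuous cc)
    (hJ2 : ContinuousOn (fun q : ℝ × ℝ => Jw q.1 q.2) (Icc (-hi) hi ×ˢ univ)) :
    ContinuousOn (fun p : ℝ × ℝ × ℝ => cd p.1 p.2.2 * cc p.1 * Jw p.2.1 p.2.2 *
      (fderiv ℝ (frameLevel μ K) (pairSumPath μ K ρ p.1 θ 0 - levelPoint μ K p.2.1 (p.2.2 + θ)))
        (iteratedDeriv 1 (levelPoint μ K 0) θ + iteratedDeriv 1 (levelPoint μ K ρ) (p.1 + θ))) (univ ×ˢ (Icc (-hi) hi ×ˢ univ)) := by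
  set B := (bandBounds (show (-4 : ℝ) < -1.1 by norm_num) (show (-1.1 : ℝ) ≤ -0.1 by norm_num) (show (-0.1 : ℝ) < 0 by norm_num)) with hBdef
  have hADt : 2 * A < B.Dtmin := by have := klCurveD_pos; linarith only [this, hd]
  -- the cut-offs and the Jacobian factor
  have h1 : Continuous fun p : ℝ × ℝ × ℝ => cd p.1 p.2.2 := hcd2.comp (continuous_fst.prodMk (continuous_snd.comp continuous_snd))
  have h2 : Continuous fun p : ℝ × ℝ × ℝ => cc p.1 := hcc.comp continuous_fst
  have h3 : ContinuousOn (fun p : ℝ × ℝ × ℝ => Jw p.2.1 p.2.2) (univ ×ˢ (Icc (-hi) hi ×ˢ univ)) :=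
    hJ2.comp continuous_snd.continuousOn fun p hp => (mem_prod.1 hp).2
  -- the partner momentum, jointly continuous on the strip
  have hS : Continuous fun p : ℝ × ℝ × ℝ => pairSumPath μ K ρ p.1 θ 0 := (continuous_pairSumPath_angle hA hd hlo hhi hρ θ).comp continuous_fst
  have hlev : ContinuousOn (fun q : ℝ × ℝ => levelPoint μ K q.1 q.2) ({x : ℝ | |x| < r} ×ˢ univ) :=
    (contDiffOn_levelPoint B hA hADt hlo hhi (m := 0)).continuousOn
  have hmap : MapsTo (fun p : ℝ × ℝ × ℝ => ((p.2.1, p.2.2 + θ) : ℝ × ℝ)) (univ ×ˢ (Icc (-hi) hi ×ˢ univ)) ({x : ℝ | |x| < r} ×ˢ univ) := by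
    intro p hp
    have he : p.2.1 ∈ Icc (-hi) hi := (mem_prod.1 (mem_prod.1 hp).2).1
    exact mem_prod.2 ⟨abs_lt.2 ⟨by linarith only [he.1, hhir], lt_of_le_of_lt he.2 hhir⟩, mem_univ _⟩
  have hf : Continuous fun p : ℝ × ℝ × ℝ => ((p.2.1, p.2.2 + θ) : ℝ × ℝ) :=
    (continuous_fst.comp continuous_snd).prodMk ((continuous_snd.comp continuous_snd).add continuous_const)
  have hΦ' := hlev.comp hf.continuousOn hmap
  have hΦ : ContinuousOn (fun p : ℝ × ℝ × ℝ => levelPoint μ K p.2.1 (p.2.2 + θ)) (univ ×ˢ (Icc (-hi) hi ×ˢ univ)) :=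
    hΦ'.congr fun p _ => rfl
  have hP : ContinuousOn (fun p : ℝ × ℝ × ℝ => pairSumPath μ K ρ p.1 θ 0 - levelPoint μ K p.2.1 (p.2.2 + θ)) (univ ×ˢ (Icc (-hi) hi ×ˢ univ)) :=
    hS.continuousOn.sub hΦ
  -- the differential and the velocity
  have hfe : Continuous (fderiv ℝ (frameLevel μ K)) := (EngineV8.contDiff_frameLevel μ K (n := 1)).continuous_fderiv one_ne_zero
  have hF : ContinuousOn (fun p : ℝ × ℝ × ℝ => fderiv ℝ (frameLevel μ K) (pairSumPath μ K ρ p.1 θ 0 - levelPoint μ K p.2.1 (p.2.2 + θ)))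
      (univ ×ˢ (Icc (-hi) hi ×ˢ univ)) := hfe.comp_continuousOn hP
  have hvel : Continuous fun p : ℝ × ℝ × ℝ => iteratedDeriv 1 (levelPoint μ K 0) θ + iteratedDeriv 1 (levelPoint μ K ρ) (p.1 + θ) :=
    continuous_const.add (((contDiff_levelPoint_of_sizes hA hd hlo hhi hρ 2).continuous_iteratedDeriv 1 (by norm_num)).comp
      (continuous_fst.add continuous_const))
  have hG := hF.clm_apply hvel.continuousOn
  exact ((h1.continuousOn.mul h2.continuousOn).mul h3).mul hG

end Sizes

end Summit.HubbardSuperconductivity.HubbardSuperconductivity.Theorems.C4a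

end
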